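import Summits.ABC.IUTFork.Cor312ProvenancePoint
import HarnessLib

/-!
# [IUTchIII] Cor. 3.12 for the Θ-data of ANY model of the curve of a `λ`-line point ⟹ the display of [IUTchIV]
# Thm. 1.10 for that point — the point dictionary depends on the curve only through `j` (c312 crew, wave 2, row W2-F′)

Record-only companion of `Cor312ProvenancePoint.lean` (seat abc-iut-c312-8, gen 2); TAKES NO SIDE on Cor. 3.12.
`Cor312ProvenancePoint` identified the [IUTchIV]-numbers of an initial Θ-datum `D` with those of a `λ`-line point WHEN the
datum's curve is the Legendre curve `y² = x(x−1)(x−λ)` of the point. In print the curve "`E_F`" of the Θ-data of [IUTchIV]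
Cor. 2.2 (ii) is a base change of a MODEL `E_{F_mod}` over `F_mod` (Thm. 1.10 p. 22: "`F = F_mod(√−1, E_{F_mod}[2·3·5])`",
"`F_tpd := F_mod(E_{F_mod}[2])`"; Cor. 2.2 (ii) p. 42: "`E_F` and `F_mod` arise as the “`E_F`” and “`F_mod`” for a collection of
initial Θ-data"), which over `F ⊇ F_tpd ∋ λ` is in general only a TWIST of the Legendre curve — same `j`-invariant
`j(E_F) = j(λ)`, possibly a different Weierstrass curve (abc-iut-L5-t7, STATUS 23:15:14Z, on the (P7) constructor). Every
quantity in the dictionary — `log(q)` ((P5): `ord_v(q_v) = −ord_v(j)` at multiplicative `v`), `d_mod = [ℚ(j):ℚ]`, the bad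
places — depends on `E_F` only through `j(E_F)` and the reduction types, so THIS FILE re-proves the dictionary for an ARBITRARY
elliptic curve `E` over the field `F` of a presentation `Q = (F, λ)` of the point with `hj : j(E) = j(λ)` (all PROVED):

* `localHeight_eq_ordMinimalDiscriminant_of_j` — at a multiplicative place of `E`: `h_v(λ) = ord_v(Δ_min(E))` (Tate, the tree's
  `log_valuation_j_eq_ordMinimalDiscriminant_of_hasMultiplicativeReductionAt`; Silverman AEC VII.5.1 (b));
* `dmod_eq_of_j` — `[F_mod : ℚ] = Cor22.dmod Q`;
* **`qArithDivisor_eq_qDivisor_of_j`**, **`logq_eq_logQAvoid_of_j`** — under the (P5) choice of `𝕍^bad_mod` read at the level of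
  `F` (`hV : v ∈ 𝕍(F)^bad ↔ (v ∤ 2 ∧ v ∤ l) ∧ E multiplicative at v`): `Cor312Prov.logq D = Cor22.logQAvoid Q {2, l}`;
* `logq_eq_logQAvoid_of_j_of_algebraMap`, `dmod_eq_of_j_of_algebraMap` — read on the point presented over a smaller field
  `F_tpd ⊆ F` (`Cor22.logQAvoid_of_algebraMap`, [IUTchIV] p. 23 "independent of the choice of `F□`");
* **`display_of_j`** / **`display_of_j_of_algebraMap`** / **`display_of_j_extend`** — THE MEETING EDGE for any model:
  `D : InitialThetaData F K Fbar E l Pb` with `j(E) = j(λ)` and (P5), a Cor. 3.12 setting `P′` with `IsSettingOf D P′`, inputs `J`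
  with `log(𝔡^{F_tpd}) := log-diff`, `log(𝔣^{F_tpd}) := Cor22.logCondAvoid _ {2,l}` of the point, proof data, `η_prm`, `l ≠ 5`:
  `P′.Statement → Cor22.Display (the point) l η_prm` — the conclusion of abc-iut-S-d2's `Cor22.Thm110Legendre` at `(η_prm, P, l)`;
  the `_extend` form takes `E` over any `F ⊇ F_tpd` (`[Algebra P.F F]`) with `hj : E.j = algebraMap F_tpd F (j(λ))` — the shape
  of L5-t7's planned `InitialThetaData.ofLegendre` on `W ⊗ F′`.
Remaining hypotheses = the named opaque inputs (existence of `D` = (P7)/L5; the lattice setting and `IsSettingOf` = campaign M,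
`q`-field now `Cor312ProvenanceLocal`/`…Mod`; `P′.Statement` = the crux; `ProofData` = campaign S). Nothing is asserted about any
elliptic curve. [claim: Mochizuki2012, status: disputed] for every quotation.
-/

noncomputable section

namespace Summit.ABC.IUTFork.Cor312Prov

open Literature.IUT.HodgeTheaters Literature.IUT.LogVolume NumberField IsDedekindDomain
open Literature.NumberTheory.DiophantineGeometry.GenEll
open scoped Classical

/-! ## 1. Any model over the presenting field: `E / Q.F` with `j(E) = j(λ)` -/

section SameField

variable {Q : NFPoint} {K Fbar : Type} [Field K] [NumberField K] [Algebra Q.F K] [Field Fbar]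
  [Algebra Q.F Fbar] [Algebra K Fbar] {l : ℕ} {Pb : BadPlacePredicates K}
  {E : WeierstrassCurve Q.F} [E.IsElliptic]

/-- **`d_mod` through `j` only**: `[F_mod : ℚ]` of a curve `E` over `F` with `j(E) = j(λ)` (`F_mod = ℚ(j(E))`, L5-t2's
`fieldOfModuli`) is S-d2's `Cor22.dmod Q = [ℚ(j(λ)):ℚ]` of the point `Q = (F, λ)`. PROVED. [claim: Mochizuki2012, status: disputed] -/
theorem dmod_eq_of_j (hj : E.j = Cor22.jInv Q.x) : dmod E = Cor22.dmod Q := by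
  unfold dmod Cor22.dmod fieldOfModuli
  rw [hj]

/-- **Tate at a multiplicative place, through `j` only**: for a curve `E` over `F` with `j(E) = j(λ)` and a place `w` of
multiplicative reduction of `E`, the point's local height `h_w(λ) = max(0, −ord_w j(λ))` is `ord_w(Δ_min(E))` (the tree's
`log_valuation_j_eq_ordMinimalDiscriminant_of_hasMultiplicativeReductionAt`, Silverman AEC VII.5.1 (b); [IUTchIV] p. 44 "`h_v` …
the local height of `E_F`"). PROVED. [claim: Mochizuki2012, status: disputed] -/
theorem localHeight_eq_ordMinimalDiscriminant_of_j (hj : E.j = Cor22.jInv Q.x) {w : HeightOneSpectrum (𝓞 Q.F)}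
    (hw : E.HasMultiplicativeReductionAt w) : Cor22.localHeight Q w = (E.ordMinimalDiscriminant w : ℝ) := by
  unfold Cor22.localHeight
  rw [← hj]
  unfold ord
  rw [neg_neg, E.log_valuation_j_eq_ordMinimalDiscriminant_of_hasMultiplicativeReductionAt w hw, Int.toNat_natCast]

/-- A place of multiplicative reduction of a curve with `j(E) = j(λ)` is a bad place (pole of `j(λ)`) of the point. PROVED.
[claim: Mochizuki2012, status: disputed] -/
theorem mem_badPlaces_of_hasMultiplicativeReductionAt_of_j (hj : E.j = Cor22.jInv Q.x) {w : HeightOneSpectrum (𝓞 Q.F)}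
    (hw : E.HasMultiplicativeReductionAt w) : w ∈ Cor22.badPlaces Q := by
  by_contra hnot
  have h0 := localHeight_eq_zero_of_not_mem_badPlaces (Q := Q) hnot
  rw [localHeight_eq_ordMinimalDiscriminant_of_j hj hw] at h0
  exact WeierstrassCurve.ordMinimalDiscriminant_ne_zero_of_hasMultiplicativeReductionAt w _ hw (by exact_mod_cast h0)

/-- A place of good reduction of a curve with `j(E) = j(λ)` is NOT a bad place of the point (`|j|_w ≤ 1`, Silverman AEC VII.5.1 (a),
the tree's `valuation_j_le_one_of_hasGoodReduction_localMinimalModel`). PROVED. [claim: Mochizuki2012, status: disputed] -/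
theorem not_mem_badPlaces_of_hasGoodReductionAt_of_j (hj : E.j = Cor22.jInv Q.x) {w : HeightOneSpectrum (𝓞 Q.F)}
    (hw : E.HasGoodReductionAt w) : w ∉ Cor22.badPlaces Q := by
  have hle : w.valuation Q.F E.j ≤ 1 := valuation_j_le_one_of_hasGoodReduction_localMinimalModel w E hw
  rw [Cor22.badPlaces, Set.Finite.mem_toFinset]
  change ¬ (1 < w.valuation Q.F (Cor22.jInv Q.x))
  rw [← hj]
  exact not_lt.mpr hle

/-- **The datum's `𝔮`-divisor IS the point's `q`-parameter divisor away from `{2, l}`, for ANY model**: `E` over `F` with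
`j(E) = j(λ)`, `D : InitialThetaData F K Fbar E l Pb` with the (P5) choice of `𝕍^bad_mod` read at the level of `F` ([IUTchIV] p. 46
(P5): the places "that do not divide `2l` and at which `E_F` has bad multiplicative reduction") ⟹ `𝔮^F_{ADiv}(D) =
Cor22.qDivisor Q {2, l}`. PROVED (Tate at the bad places; semistability of `E` — [IUTchI] Def. 3.1 (b) — and `|j|_w ≤ 1` at
good `w` elsewhere). [claim: Mochizuki2012, status: disputed] -/
theorem qArithDivisor_eq_qDivisor_of_j (hj : E.j = Cor22.jInv Q.x) (D : InitialThetaData Q.F K Fbar E l Pb)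
    (hV : ∀ v : FinitePlace Q.F, v ∈ D.VFbad ↔
      (∀ p ∈ ({2, l} : Finset ℕ), ((p : ℕ) : 𝓞 Q.F) ∉ v.maximalIdeal.asIdeal) ∧
        E.HasMultiplicativeReductionAt v.maximalIdeal) :
    qArithDivisor D (vFbad_finite D) = Cor22.qDivisor Q {2, l} := by
  ext w
  rw [qArithDivisor_apply, Cor22.qDivisor_apply]
  have hVw := hV (FinitePlace.mk w)
  rw [FinitePlace.maximalIdeal_mk] at hVw
  by_cases hw : FinitePlace.mk w ∈ D.VFbad
  · obtain ⟨hS, hmult⟩ := hVw.mp hw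
    rw [if_pos hw, if_pos ⟨mem_badPlaces_of_hasMultiplicativeReductionAt_of_j hj hmult, hS⟩,
      localHeight_eq_ordMinimalDiscriminant_of_j hj hmult]
    rfl
  · rw [if_neg hw]
    by_cases hS : ∀ p ∈ ({2, l} : Finset ℕ), ((p : ℕ) : 𝓞 Q.F) ∉ w.asIdeal
    · have hnm : ¬ E.HasMultiplicativeReductionAt w := fun hm => hw (hVw.mpr ⟨hS, hm⟩)
      have hgood : E.HasGoodReductionAt w := (D.isSemistable w).resolve_right hnm
      rw [if_neg (fun h => not_mem_badPlaces_of_hasGoodReductionAt_of_j hj hgood h.1)]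
    · rw [if_neg (fun h => hS h.2)]

/-- **`log(q)` of the datum `=` `log(q^{∤{2,l}}(λ))` of the point, for ANY model** with `j(E) = j(λ)` and the (P5) choice.
PROVED. [claim: Mochizuki2012, status: disputed] -/
theorem logq_eq_logQAvoid_of_j (hj : E.j = Cor22.jInv Q.x) (D : InitialThetaData Q.F K Fbar E l Pb)
    (hV : ∀ v : FinitePlace Q.F, v ∈ D.VFbad ↔
      (∀ p ∈ ({2, l} : Finset ℕ), ((p : ℕ) : 𝓞 Q.F) ∉ v.maximalIdeal.asIdeal) ∧
        E.HasMultiplicativeReductionAt v.maximalIdeal) :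
    logq D = Cor22.logQAvoid Q {2, l} := by
  rw [logq_eq_ndeg_qArithDivisor, qArithDivisor_eq_qDivisor_of_j hj D hV]
  rfl

/-- The same, read on the point presented over a smaller field `F_tpd ⊆ F` over which `λ` is defined (`hx`; [IUTchIV] p. 23
"independent of the choice of `F□`"). PROVED. [claim: Mochizuki2012, status: disputed] -/
theorem logq_eq_logQAvoid_of_j_of_algebraMap {P₀ : NFPoint} [Algebra P₀.F Q.F] (hx : Q.x = algebraMap P₀.F Q.F P₀.x)
    (hj : E.j = Cor22.jInv Q.x) (D : InitialThetaData Q.F K Fbar E l Pb)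
    (hV : ∀ v : FinitePlace Q.F, v ∈ D.VFbad ↔
      (∀ p ∈ ({2, l} : Finset ℕ), ((p : ℕ) : 𝓞 Q.F) ∉ v.maximalIdeal.asIdeal) ∧
        E.HasMultiplicativeReductionAt v.maximalIdeal) :
    logq D = Cor22.logQAvoid P₀ {2, l} := by
  rw [logq_eq_logQAvoid_of_j hj D hV, Cor22.logQAvoid_of_algebraMap hx]

/-- `d_mod` through `j`, read on the point over a smaller field. PROVED. [claim: Mochizuki2012, status: disputed] -/
theorem dmod_eq_of_j_of_algebraMap {P₀ : NFPoint} [Algebra P₀.F Q.F] (hx : Q.x = algebraMap P₀.F Q.F P₀.x)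
    (hj : E.j = Cor22.jInv Q.x) : dmod E = Cor22.dmod P₀ := by
  rw [dmod_eq_of_j hj, Cor22.dmod_of_algebraMap hx]

/-- **THE MEETING EDGE for any model of the point's curve.** `E` over `F` with `j(E) = j(λ)` (`Q = (F, λ)`), `D` initial Θ-data over
`E` with the (P5) choice, `P′` a Cor. 3.12 setting with `IsSettingOf D P′`, inputs `J` with `log(𝔡^{F_tpd}) := Q.logDiff`,
`log(𝔣^{F_tpd}) := Cor22.logCondAvoid Q {2,l}`, proof data, `η_prm`, `l ≠ 5`: `P′.Statement → Cor22.Display Q l η_prm` ([IUTchIV]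
p. 46 l. 1, with `e*_mod ≤ d*_mod`). PROVED. [claim: Mochizuki2012, status: disputed] -/
theorem display_of_j (hj : E.j = Cor22.jInv Q.x) (D : InitialThetaData Q.F K Fbar E l Pb)
    (hV : ∀ v : FinitePlace Q.F, v ∈ D.VFbad ↔
      (∀ p ∈ ({2, l} : Finset ℕ), ((p : ℕ) : 𝓞 Q.F) ∉ v.maximalIdeal.asIdeal) ∧
        E.HasMultiplicativeReductionAt v.maximalIdeal)
    {T : Thm311.ThetaIndex} {S : Thm311.Situation T} {P : Cor312.Setting S} (h : IsSettingOf D P)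
    (J : NumericsInputs D) (hJd : J.logDiffTpd = Q.logDiff) (hJc : J.logCondTpd = Cor22.logCondAvoid Q {2, l})
    (PD : (numericsOf D P J).ProofData) (hη : IsEtaPrm J.etaPrm) (h5 : l ≠ 5) (hstat : P.Statement) :
    Cor22.Display Q l J.etaPrm := by
  have hd : (numericsOf D P J).Display :=
    (Thm110Numerics.theorem110 PD hη h5 ((numericsOf_cor312_iff P J h).mpr hstat)).2.2.1
  have hd' : 1 / 6 * logq D ≤
      (1 + 20 * (dmod E : ℝ) / l) * (J.logDiffTpd + J.logCondTpd)
        + 20 * (((2 ^ 12 * 3 ^ 3 * 5 * J.emod : ℕ) : ℝ) * l + J.etaPrm) := hd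
  rw [logq_eq_logQAvoid_of_j hj D hV, dmod_eq_of_j hj, hJd, hJc] at hd'
  unfold Cor22.Display
  have hem : ((2 ^ 12 * 3 ^ 3 * 5 * J.emod : ℕ) : ℝ) * l ≤ 2 ^ 12 * 3 ^ 3 * 5 * (Cor22.dmod Q : ℝ) * l := by
    have h1 : (J.emod : ℝ) ≤ (Cor22.dmod Q : ℝ) := by
      rw [← dmod_eq_of_j hj]
      exact_mod_cast J.emod_le_dmod
    have h2 : ((2 ^ 12 * 3 ^ 3 * 5 * J.emod : ℕ) : ℝ) ≤ 2 ^ 12 * 3 ^ 3 * 5 * (Cor22.dmod Q : ℝ) := by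
      push_cast
      linarith
    exact mul_le_mul_of_nonneg_right h2 (Nat.cast_nonneg l)
  refine hd'.trans ?_
  gcongr

/-- The meeting edge for any model, read on the point presented over a smaller field `F_tpd ⊆ F` (`P₀ = (F_tpd, λ)`, `hx`; inputs
`J` with the log-different / log-conductor of `P₀`): `P′.Statement → Cor22.Display P₀ l η_prm` — the conclusion of S-d2's
`Cor22.Thm110Legendre` at `(η_prm, P₀, l)`. PROVED. [claim: Mochizuki2012, status: disputed] -/
theorem display_of_j_of_algebraMap {P₀ : NFPoint} [Algebra P₀.F Q.F] (hx : Q.x = algebraMap P₀.F Q.F P₀.x)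
    (hj : E.j = Cor22.jInv Q.x) (D : InitialThetaData Q.F K Fbar E l Pb)
    (hV : ∀ v : FinitePlace Q.F, v ∈ D.VFbad ↔
      (∀ p ∈ ({2, l} : Finset ℕ), ((p : ℕ) : 𝓞 Q.F) ∉ v.maximalIdeal.asIdeal) ∧
        E.HasMultiplicativeReductionAt v.maximalIdeal)
    {T : Thm311.ThetaIndex} {S : Thm311.Situation T} {P : Cor312.Setting S} (h : IsSettingOf D P)
    (J : NumericsInputs D) (hJd : J.logDiffTpd = P₀.logDiff) (hJc : J.logCondTpd = Cor22.logCondAvoid P₀ {2, l})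
    (PD : (numericsOf D P J).ProofData) (hη : IsEtaPrm J.etaPrm) (h5 : l ≠ 5) (hstat : P.Statement) :
    Cor22.Display P₀ l J.etaPrm := by
  have hd : (numericsOf D P J).Display :=
    (Thm110Numerics.theorem110 PD hη h5 ((numericsOf_cor312_iff P J h).mpr hstat)).2.2.1
  have hd' : 1 / 6 * logq D ≤
      (1 + 20 * (dmod E : ℝ) / l) * (J.logDiffTpd + J.logCondTpd)
        + 20 * (((2 ^ 12 * 3 ^ 3 * 5 * J.emod : ℕ) : ℝ) * l + J.etaPrm) := hd
  rw [logq_eq_logQAvoid_of_j_of_algebraMap hx hj D hV, dmod_eq_of_j_of_algebraMap hx hj, hJd, hJc] at hd'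
  unfold Cor22.Display
  have hem : ((2 ^ 12 * 3 ^ 3 * 5 * J.emod : ℕ) : ℝ) * l ≤ 2 ^ 12 * 3 ^ 3 * 5 * (Cor22.dmod P₀ : ℝ) * l := by
    have h1 : (J.emod : ℝ) ≤ (Cor22.dmod P₀ : ℝ) := by
      rw [← dmod_eq_of_j_of_algebraMap hx hj]
      exact_mod_cast J.emod_le_dmod
    have h2 : ((2 ^ 12 * 3 ^ 3 * 5 * J.emod : ℕ) : ℝ) ≤ 2 ^ 12 * 3 ^ 3 * 5 * (Cor22.dmod P₀ : ℝ) := by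
      push_cast
      linarith
    exact mul_le_mul_of_nonneg_right h2 (Nat.cast_nonneg l)
  refine hd'.trans ?_
  gcongr

end SameField

/-! ## 2. Any model over any field `F ⊇ F_tpd`: `E / F` with `j(E) = j(λ)` viewed in `F` -/

section Extend

variable {P₀ : NFPoint} {F : Type} [Field F] [NumberField F] [Algebra P₀.F F] {K' Fbar' : Type} [Field K']
  [NumberField K'] [Algebra F K'] [Field Fbar'] [Algebra F Fbar'] [Algebra K' Fbar'] {Pb' : BadPlacePredicates K'}
  {E : WeierstrassCurve F} [E.IsElliptic] {l : ℕ}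

/-- **`log(q)` of a datum over ANY curve `E / F`, `F ⊇ F_tpd`, with `j(E) = j(λ)`** (e.g. the base change `E_{F_mod} ⊗ F` of a
model over `F_mod`, a twist of the Legendre curve — abc-iut-L5-t7's planned `InitialThetaData.ofLegendre`), with the (P5) choice,
IS `Cor22.logQAvoid P₀ {2, l}` of the point `P₀ = (F_tpd, λ)`. PROVED (`Q := Cor22.extend P₀ F`). [claim: Mochizuki2012, status: disputed] -/
theorem logq_eq_logQAvoid_of_j_extend (hj : E.j = algebraMap P₀.F F (Cor22.jInv P₀.x))
    (D : InitialThetaData F K' Fbar' E l Pb')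
    (hV : ∀ v : FinitePlace F, v ∈ D.VFbad ↔
      (∀ p ∈ ({2, l} : Finset ℕ), ((p : ℕ) : 𝓞 F) ∉ v.maximalIdeal.asIdeal) ∧
        E.HasMultiplicativeReductionAt v.maximalIdeal) :
    logq D = Cor22.logQAvoid P₀ {2, l} :=
  letI : Algebra (Cor22.extend P₀ F).F K' := ‹Algebra F K'›
  letI : Algebra (Cor22.extend P₀ F).F Fbar' := ‹Algebra F Fbar'›
  letI : Algebra P₀.F (Cor22.extend P₀ F).F := ‹Algebra P₀.F F›
  haveI : @WeierstrassCurve.IsElliptic (Cor22.extend P₀ F).F _ E := ‹E.IsElliptic›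
  have hj' : E.j = Cor22.jInv (Cor22.extend P₀ F).x := by
    rw [hj]; exact (Cor22.jInv_of_algebraMap (P := P₀) (Q := Cor22.extend P₀ F) rfl).symm
  logq_eq_logQAvoid_of_j_of_algebraMap (Q := Cor22.extend P₀ F) (P₀ := P₀) rfl hj' D hV

/-- `d_mod` of ANY curve `E / F` with `j(E) = j(λ)` is `Cor22.dmod P₀`. PROVED. [claim: Mochizuki2012, status: disputed] -/
theorem dmod_eq_of_j_extend (hj : E.j = algebraMap P₀.F F (Cor22.jInv P₀.x)) : dmod E = Cor22.dmod P₀ :=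
  letI : Algebra P₀.F (Cor22.extend P₀ F).F := ‹Algebra P₀.F F›
  haveI : @WeierstrassCurve.IsElliptic (Cor22.extend P₀ F).F _ E := ‹E.IsElliptic›
  have hj' : E.j = Cor22.jInv (Cor22.extend P₀ F).x := by
    rw [hj]; exact (Cor22.jInv_of_algebraMap (P := P₀) (Q := Cor22.extend P₀ F) rfl).symm
  dmod_eq_of_j_of_algebraMap (Q := Cor22.extend P₀ F) (P₀ := P₀) rfl hj'

/-- **THE MEETING EDGE for any model over any `F ⊇ F_tpd`** — the shape of the (P7) constructor: `E / F` with
`j(E) = j(λ)` in `F`, `D : InitialThetaData F K Fbar E l Pb` with the (P5) choice, `IsSettingOf D P′`, inputs `J` with the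
log-different / log-conductor of the point `P₀ = (F_tpd, λ)`, proof data, `η_prm`, `l ≠ 5`:
`P′.Statement → Cor22.Display P₀ l η_prm` (= the conclusion of S-d2's `Cor22.Thm110Legendre` at `(η_prm, P₀, l)`). PROVED.
[claim: Mochizuki2012, status: disputed] -/
theorem display_of_j_extend (hj : E.j = algebraMap P₀.F F (Cor22.jInv P₀.x))
    (D : InitialThetaData F K' Fbar' E l Pb')
    (hV : ∀ v : FinitePlace F, v ∈ D.VFbad ↔
      (∀ p ∈ ({2, l} : Finset ℕ), ((p : ℕ) : 𝓞 F) ∉ v.maximalIdeal.asIdeal) ∧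
        E.HasMultiplicativeReductionAt v.maximalIdeal)
    {T : Thm311.ThetaIndex} {S : Thm311.Situation T} {P : Cor312.Setting S} (h : IsSettingOf D P)
    (J : NumericsInputs D) (hJd : J.logDiffTpd = P₀.logDiff) (hJc : J.logCondTpd = Cor22.logCondAvoid P₀ {2, l})
    (PD : (numericsOf D P J).ProofData) (hη : IsEtaPrm J.etaPrm) (h5 : l ≠ 5) (hstat : P.Statement) :
    Cor22.Display P₀ l J.etaPrm :=
  letI : Algebra (Cor22.extend P₀ F).F K' := ‹Algebra F K'›
  letI : Algebra (Cor22.extend P₀ F).F Fbar' := ‹Algebra F Fbar'›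
  letI : Algebra P₀.F (Cor22.extend P₀ F).F := ‹Algebra P₀.F F›
  haveI : @WeierstrassCurve.IsElliptic (Cor22.extend P₀ F).F _ E := ‹E.IsElliptic›
  have hj' : E.j = Cor22.jInv (Cor22.extend P₀ F).x := by
    rw [hj]; exact (Cor22.jInv_of_algebraMap (P := P₀) (Q := Cor22.extend P₀ F) rfl).symm
  display_of_j_of_algebraMap (Q := Cor22.extend P₀ F) (P₀ := P₀) rfl hj' D hV h J hJd hJc PD hη h5 hstat

end Extend

end Summit.ABC.IUTFork.Cor312Prov

end
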